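import Literature.AlgebraicGeometry.Modules.AffineVanishing
import Literature.AlgebraicGeometry.Modules.InjectiveModuleFlasque
import Literature.AlgebraicGeometry.Modules.IsoOfSectionsOnBasis
import Literature.AlgebraicGeometry.HodgeTheory.AtiyahClass
import Literature.Topology.OpenSubspaceCohomology
import Literature.Algebra.Homology.LeftExactAcyclicClass
import Mathlib.AlgebraicGeometry.Morphisms.Affine
import Mathlib.Algebra.Homology.Factorizations.CM5a
import HarnessLib

/-!
# Higher direct images of quasi-coherent modules along an affine morphism vanish — in the form
# "`g_*` of an injective resolution of a bounded-below quasi-coherent complex is a quasi-isomorphism"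

The Stacks Project, Tag 01XC (Cohomology of Schemes, Lemma 30.2.3: for `g : X → Y` affine and `𝓕`
quasi-coherent, `Rⁱ g_* 𝓕 = 0`, `i > 0`) and Hartshorne III Prop. 8.1 (`Rⁱ f_* 𝓕` is the sheaf
associated to `V ↦ Hⁱ(f⁻¹V, 𝓕)`), combined with Leray's acyclicity lemma (Hartshorne III Prop. 1.2A; the
tree's `Literature/Algebra/Homology/LeftExactAcyclicClass`), WITHOUT constructing `Rⁱ g_*`: for a scheme
morphism `g : X ⟶ Y` we call an `𝒪_X`-module `F` **`g_*`-acyclic** (`IsPushforwardAcyclic g F`) when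
`Hⁿ⁺¹(g⁻¹V, F) := Extⁿ⁺¹(ℤ[h_{g⁻¹V}], F^{ab}) = 0` for every AFFINE open `V ⊆ Y` and every `n` (cohomology
of the open `g⁻¹V` on the site of `X`, the model of `Literature/Algebra/Homology/CartanCriterion` /
`Modules/AffineVanishing`). Then:

* `IsAcyclicOn.of_isFlasque`, `IsPushforwardAcyclic.of_injective` — injective `𝒪_X`-modules are
  `g_*`-acyclic for every `g` (they are flasque, Hartshorne III.2.4 `isFlasque_of_injective_modules`;
  flasque sheaves have no higher cohomology on any open, III.2.5 + Tag 01E1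
  `OpenSubspaceCohomology.mapExt_bijective`);
* `IsPushforwardAcyclic.of_isAffineLocalizing` — for `g` AFFINE, affine-localizing (⊇ quasi-coherent ⊇
  finite locally free) modules are `g_*`-acyclic (Serre's Tag 01XB on the affine opens `g⁻¹V`,
  `AffineVanishing.subsingleton_ext_freeSheaf_of_isAffineOpen`);
* `IsAcyclicOn.of_shortExact₂/₃`, `surjective_app_of_shortExact` — closure under extensions / cokernels
  of monos, and `Γ(U, X₂) → Γ(U, X₃)` is onto when `H¹(U, X₁) = 0` (long exact `Ext` sequence);
* **`acyclicClass_pushforward`** — for any `g`, `IsPushforwardAcyclic g` is an `AcyclicClass` for the left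
  exact functor `g_* = Scheme.Modules.pushforward g` (epimorphisms tested on affine opens,
  `epi_of_surjective_app_of_isAffineOpen`);
* **`quasiIso_pushforward_map_of_isPushforwardAcyclic`**,
  **`quasiIso_pushforward_map_of_injective_of_isAffineLocalizing`** (the same statement, with
  `IsStrictlyGE` bounds, as `Modules/PushforwardInjectiveResolution.quasiIso_pushforward_map_of_injective`,
  core-w5's sections-level proof of the same hour; here it is the two-line corollary of the acyclic
  class) —
  `g_*` carries a quasi-isomorphism `E• → I•` between bounded-below complexes with `g_*`-acyclic terms —
  in particular an injective resolution of a bounded-below complex of affine-localizing modules along an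
  AFFINE `g` — to a quasi-isomorphism: **`Rg_* E• = g_* E•`** in the only form the derived adjunction
  `Hom_D(g^*M•, E•) ≅ Hom_D(M•, g_*E•)` consumes (`Literature/Algebra/Homology/KInjectiveAdjunction`,
  `shiftedHomLinearEquivOfAdjunctionOfQuasiIso`);
* `exists_injectiveResolution_pushforward_quasiIso` — packaged with Mathlib's existence of injective
  resolutions of bounded-below complexes (`CochainComplex.Plus.modelCategoryQuillen.exists_quasiIso_injective`,
  enough injectives in `Mod(𝒪_X)`: `Modules/ModulesGrothendieckAbelian`).

Complements `Modules/PushforwardAffineExact` (`quasiIso_map_pushforward`: both complexes with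
affine-localizing terms) with the MIXED quasi-coherent → injective case. Everything proved; no named fact.

## References
* The Stacks Project, Tag 01XC (Lemma 30.2.3), Tag 01XB (Lemma 30.2.2), Tag 01E1. [StacksProject]
* R. Hartshorne, *Algebraic Geometry*, GTM 52 (1977), III Prop. 8.1, III Prop. 1.2A, III.2.4–2.5,
  III Thm. 3.5. [Hartshorne1977]
-/

noncomputable section

-- `TopCat.Presheaf`/`Scheme.Modules` are not reducible (as in Mathlib's `AlgebraicGeometry/Modules/Sheaf.lean`).
set_option backward.isDefEq.respectTransparency false

open CategoryTheory CategoryTheory.Limits CategoryTheory.Abelian AlgebraicGeometry TopologicalSpace Opposite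
open Literature.Algebra.Homology Literature.AlgebraicGeometry.HodgeTheory

universe u

namespace Literature.AlgebraicGeometry.Modules

variable {X Y : Scheme.{u}}

/-! ### Acyclicity of a module on an open: `Hⁿ⁺¹(U, F) = 0` -/

/-- **`F` is acyclic on the open `U`**: `Hⁿ⁺¹(U, F) := Extⁿ⁺¹(ℤ[h_U], F^{ab}) = 0` for all `n`, the
cohomology of the object `U` of the site of `X` with coefficients in the underlying abelian sheaf of `F`
(Tag 01E1: this is `Hⁿ⁺¹(U, F|_U)`). [cite: StacksProject, Tag 01E1] -/
def IsAcyclicOn (F : X.Modules) (U : X.Opens) : Prop :=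
  ∀ n : ℕ, Subsingleton (Ext.{u} (freeSheaf.{u} (Opens.grothendieckTopology X) U)
    ((modulesToSheaf X).obj F) (n + 1))

/-- **`F` is `g_*`-acyclic** (effaceable form of `Rⁱ g_* F = 0`, `i > 0`; Hartshorne III.8.1: `Rⁱ g_* F` is
the sheaf attached to `V ↦ Hⁱ(g⁻¹V, F)`): `F` is acyclic on the preimage of every affine open of `Y`.
[cite: Hartshorne1977, III Prop. 8.1] -/
def IsPushforwardAcyclic (g : X ⟶ Y) (F : X.Modules) : Prop :=
  ∀ V : Y.Opens, IsAffineOpen V → IsAcyclicOn F (g ⁻¹ᵁ V)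

namespace IsAcyclicOn

/-- **Flasque sheaves are acyclic on every open** (Hartshorne III.2.5 on the open subspace `U`, carried
back to the site of `X` by Tag 01E1 `OpenSubspaceCohomology.mapExt_bijective`).
[cite: Hartshorne1977, III Prop. 2.5] [cite: StacksProject, Tag 01E1] -/
theorem subsingleton_ext_freeSheaf_of_isFlasque {T : TopCat.{u}}
    (G : Sheaf (Opens.grothendieckTopology T) AddCommGrpCat.{u}) [TopCat.Sheaf.IsFlasque G]
    (U : Opens T) (n : ℕ) :
    Subsingleton (Ext.{u} (freeSheaf.{u} (Opens.grothendieckTopology T) U) G (n + 1)) := by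
  have hf := U.isOpenEmbedding
  -- on the open subspace: `G|_U` is flasque, hence acyclic, and `ℤ[h_U]|_U ≅ ℤ_U`
  haveI := Literature.Topology.OpenSubspaceCohomology.isFlasque_res hf G
  haveI : Subsingleton (Sheaf.H.{u} ((Literature.Topology.OpenSubspaceCohomology.res hf).obj G) (n + 1)) :=
    Literature.AlgebraicGeometry.Motives.subsingleton_H_of_isFlasque _ _ (Nat.succ_pos n)
  haveI : Subsingleton (Ext.{u} ((Literature.Topology.OpenSubspaceCohomology.res hf).obj
      (freeSheaf.{u} (Opens.grothendieckTopology T) (Literature.Topology.OpenSubspaceCohomology.U₀ hf)))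
      ((Literature.Topology.OpenSubspaceCohomology.res hf).obj G) (n + 1)) :=
    Ext.subsingleton_of_iso_left (Literature.Topology.OpenSubspaceCohomology.constantSheafIsoRes hf) (n + 1)
  -- restriction is injective on `Ext`; `U₀ = U`
  have key : ∀ (W : Opens T), Literature.Topology.OpenSubspaceCohomology.U₀ hf = W →
      Subsingleton (Ext.{u} (freeSheaf.{u} (Opens.grothendieckTopology T) W) G (n + 1)) := by
    rintro W rfl
    exact ⟨fun x y => (Literature.Topology.OpenSubspaceCohomology.mapExt_bijective hf G (n + 1)).1
      (Subsingleton.elim _ _)⟩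
  exact key U U.isOpenEmbedding_obj_top

/-- An injective `𝒪_X`-module is acyclic on every open (it is flasque, Hartshorne III.2.4).
[cite: Hartshorne1977, III.2.4] -/
theorem of_injective (I : X.Modules) [Injective I] (U : X.Opens) : IsAcyclicOn I U := by
  haveI : TopCat.Sheaf.IsFlasque ((modulesToSheaf X).obj I) := isFlasque_of_injective_modules I
  exact fun n => subsingleton_ext_freeSheaf_of_isFlasque (T := X.carrier) ((modulesToSheaf X).obj I) U n

/-- **Serre vanishing**: an affine-localizing (e.g. quasi-coherent) module is acyclic on every affine open.
[cite: StacksProject, Tag 01XB] [cite: Hartshorne1977, III Thm. 3.5] -/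
theorem of_isAffineLocalizing {F : X.Modules} (hF : IsAffineLocalizing F) {U : X.Opens}
    (hU : IsAffineOpen U) : IsAcyclicOn F U :=
  fun n => AffineVanishing.subsingleton_ext_freeSheaf_of_isAffineOpen F hF hU n

/-- The zero module is acyclic on every open. [cite: Hartshorne1977, III Prop. 1.2A] -/
theorem of_isZero {F : X.Modules} (hF : IsZero F) (U : X.Opens) : IsAcyclicOn F U := by
  haveI : Injective F := hF.injective
  exact of_injective F U

variable {S : ShortComplex X.Modules} (hS : S.ShortExact) (U : X.Opens)
include hS

/-- Acyclicity on `U` is closed under extensions. [cite: Hartshorne1977, III Prop. 1.2A] -/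
theorem of_shortExact₂ (h₁ : IsAcyclicOn S.X₁ U) (h₃ : IsAcyclicOn S.X₃ U) : IsAcyclicOn S.X₂ U := by
  intro n
  haveI : Subsingleton (Ext.{u} (freeSheaf.{u} (Opens.grothendieckTopology X) U)
      (S.map (modulesToSheaf X)).X₁ (n + 1)) := h₁ n
  haveI : Subsingleton (Ext.{u} (freeSheaf.{u} (Opens.grothendieckTopology X) U)
      (S.map (modulesToSheaf X)).X₃ (n + 1)) := h₃ n
  exact Literature.AlgebraicGeometry.Motives.Ext.subsingleton_X₂ _ (hS.map_of_exact (modulesToSheaf X)) (n + 1)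

/-- Acyclicity on `U` passes to the cokernel of a monomorphism between acyclics.
[cite: Hartshorne1977, III Prop. 1.2A] -/
theorem of_shortExact₃ (h₁ : IsAcyclicOn S.X₁ U) (h₂ : IsAcyclicOn S.X₂ U) : IsAcyclicOn S.X₃ U := by
  intro n
  haveI : Subsingleton (Ext.{u} (freeSheaf.{u} (Opens.grothendieckTopology X) U)
      (S.map (modulesToSheaf X)).X₂ (n + 1)) := h₂ n
  haveI : Subsingleton (Ext.{u} (freeSheaf.{u} (Opens.grothendieckTopology X) U)
      (S.map (modulesToSheaf X)).X₁ (n + 1 + 1)) := h₁ (n + 1)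
  exact Literature.AlgebraicGeometry.Motives.Ext.subsingleton_X₃ _ (hS.map_of_exact (modulesToSheaf X)) (n + 1)

/-- **`H¹(U, X₁) = 0 ⇒ Γ(U, X₂) → Γ(U, X₃)` is surjective** for a short exact `0 → X₁ → X₂ → X₃ → 0`
(the long exact cohomology sequence in degrees `0 → 1`; `Hom(ℤ[h_U], –) = Γ(U, –)`).
[cite: Hartshorne1977, III Prop. 1.2A] -/
theorem surjective_app_of_shortExact (h₁ : IsAcyclicOn S.X₁ U) : Function.Surjective (S.g.app U) := by
  intro t
  haveI : HasExt.{u} (Sheaf (Opens.grothendieckTopology X) AddCommGrpCat.{u}) := inferInstance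
  let S' := S.map (modulesToSheaf X)
  have hS' : S'.ShortExact := hS.map_of_exact (modulesToSheaf X)
  haveI : Subsingleton (Ext.{u} (freeSheaf.{u} (Opens.grothendieckTopology X) U) S'.X₁ 1) := h₁ 0
  let x₃ : Ext.{u} (freeSheaf.{u} (Opens.grothendieckTopology X) U) S'.X₃ 0 :=
    Ext.mk₀ ((freeSheafHomEquiv U S'.X₃).symm t)
  obtain ⟨x₂, hx₂⟩ : ∃ x₂ : Ext.{u} (freeSheaf.{u} (Opens.grothendieckTopology X) U) S'.X₂ 0,
      x₂.comp (Ext.mk₀ S'.g) (add_zero 0) = x₃ :=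
    Ext.covariant_sequence_exact₃ _ hS' x₃ (zero_add 1) (Subsingleton.elim _ _)
  refine ⟨freeSheafHomEquiv U S'.X₂ (Ext.homEquiv₀ x₂), ?_⟩
  have h : Ext.homEquiv₀ x₂ ≫ S'.g = (freeSheafHomEquiv U S'.X₃).symm t := by
    apply Ext.homEquiv₀.symm.injective
    change Ext.mk₀ _ = Ext.mk₀ _
    rw [← Ext.mk₀_comp_mk₀, Ext.mk₀_homEquiv₀_apply, hx₂]
  have h' := congrArg (freeSheafHomEquiv U S'.X₃) h
  rw [freeSheafHomEquiv_comp, Equiv.apply_symm_apply] at h'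
  exact h'

end IsAcyclicOn

namespace IsPushforwardAcyclic

variable (g : X ⟶ Y)

/-- Injective modules are `g_*`-acyclic. [cite: Hartshorne1977, III.2.4] -/
theorem of_injective (I : X.Modules) [Injective I] : IsPushforwardAcyclic g I :=
  fun _ _ => IsAcyclicOn.of_injective I _

/-- Zero modules are `g_*`-acyclic. [cite: Hartshorne1977, III Prop. 1.2A] -/
theorem of_isZero {F : X.Modules} (hF : IsZero F) : IsPushforwardAcyclic g F :=
  fun _ _ => IsAcyclicOn.of_isZero hF _

/-- **Affine-localizing (⊇ quasi-coherent) modules are `g_*`-acyclic along an AFFINE morphism**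
(`g⁻¹V` is affine for `V` affine; Serre vanishing Tag 01XB). [cite: StacksProject, Tag 01XC] -/
theorem of_isAffineLocalizing [IsAffineHom g] {F : X.Modules} (hF : IsAffineLocalizing F) :
    IsPushforwardAcyclic g F :=
  fun _ hV => IsAcyclicOn.of_isAffineLocalizing hF (hV.preimage g)

variable {S : ShortComplex X.Modules} (hS : S.ShortExact)
include hS

/-- Closure under extensions. [cite: Hartshorne1977, III Prop. 1.2A] -/
theorem of_shortExact₂ (h₁ : IsPushforwardAcyclic g S.X₁) (h₃ : IsPushforwardAcyclic g S.X₃) :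
    IsPushforwardAcyclic g S.X₂ :=
  fun V hV => IsAcyclicOn.of_shortExact₂ hS _ (h₁ V hV) (h₃ V hV)

/-- Closure under cokernels of monomorphisms. [cite: Hartshorne1977, III Prop. 1.2A] -/
theorem of_shortExact₃ (h₁ : IsPushforwardAcyclic g S.X₁) (h₂ : IsPushforwardAcyclic g S.X₂) :
    IsPushforwardAcyclic g S.X₃ :=
  fun V hV => IsAcyclicOn.of_shortExact₃ hS _ (h₁ V hV) (h₂ V hV)

/-- **`g_*` is right exact on short exact sequences whose kernel is `g_*`-acyclic**: `g_*X₂ → g_*X₃` is an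
epimorphism (surjective on every affine open `V`, since `H¹(g⁻¹V, X₁) = 0`).
[cite: Hartshorne1977, III Prop. 8.1] [cite: StacksProject, Tag 01XC] -/
theorem epi_pushforward_map (h₁ : IsPushforwardAcyclic g S.X₁) :
    Epi ((Scheme.Modules.pushforward g).map S.g) :=
  epi_of_surjective_app_of_isAffineOpen _ fun V hV => by
    rw [Scheme.Modules.pushforward_map_app]
    exact IsAcyclicOn.surjective_app_of_shortExact hS _ (h₁ V hV)

end IsPushforwardAcyclic

/-! ### `g_*`-acyclic modules form an acyclic class; Leray for `g_*` -/

section Leray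

variable (g : X ⟶ Y)

/-- **The `g_*`-acyclic modules form an acyclic class for the left exact functor `g_*`**
(`Literature/Algebra/Homology/LeftExactAcyclicClass`). [cite: Hartshorne1977, III Prop. 1.2A] -/
theorem acyclicClass_pushforward :
    AcyclicClass (Scheme.Modules.pushforward g) (IsPushforwardAcyclic g) where
  zero _ hF := IsPushforwardAcyclic.of_isZero g hF
  ext _ hS h₁ h₃ := IsPushforwardAcyclic.of_shortExact₂ g hS h₁ h₃
  quotient _ hS h₁ h₂ := IsPushforwardAcyclic.of_shortExact₃ g hS h₁ h₂
  epi_map _ hS h₁ := IsPushforwardAcyclic.epi_pushforward_map g hS h₁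

/-- **Leray's acyclicity lemma for `g_*`**: `g_*` of a bounded-below ACYCLIC complex with `g_*`-acyclic
terms is acyclic. [cite: Hartshorne1977, III Prop. 1.2A] [cite: StacksProject, Tag 01XC] -/
theorem acyclic_pushforward_map (K : CochainComplex X.Modules ℤ) (a : ℤ) [K.IsStrictlyGE a]
    (hK : K.Acyclic) (hKP : ∀ n, IsPushforwardAcyclic g (K.X n)) :
    (((Scheme.Modules.pushforward g).mapHomologicalComplex (ComplexShape.up ℤ)).obj K).Acyclic :=
  (acyclicClass_pushforward g).acyclic_map K a hK hKP

/-- **`g_*` preserves quasi-isomorphisms between bounded-below complexes with `g_*`-acyclic terms.**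
[cite: Hartshorne1977, III Prop. 1.2A] [cite: StacksProject, Tag 01XC] -/
theorem quasiIso_pushforward_map_of_isPushforwardAcyclic {K L : CochainComplex X.Modules ℤ}
    (φ : K ⟶ L) [QuasiIso φ] (a : ℤ) [K.IsStrictlyGE a] [L.IsStrictlyGE a]
    (hK : ∀ n, IsPushforwardAcyclic g (K.X n)) (hL : ∀ n, IsPushforwardAcyclic g (L.X n)) :
    QuasiIso (((Scheme.Modules.pushforward g).mapHomologicalComplex (ComplexShape.up ℤ)).map φ) :=
  (acyclicClass_pushforward g).quasiIso_map φ a hK hL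

/-- **`Rg_* E• = g_* E•` for an affine `g` and a bounded-below complex `E•` of quasi-coherent modules,
in resolution form**: if `ι : E• → I•` is a quasi-isomorphism into a bounded-below complex of injective
`𝒪_X`-modules and the terms of `E•` are affine-localizing (⊇ quasi-coherent ⊇ finite locally free),
then `g_* ι : g_*E• → g_*I•` is a quasi-isomorphism (Tag 01XC `Rⁱ g_* = 0` on quasi-coherents for affine
`g`, through Leray's acyclicity lemma). [cite: StacksProject, Tag 01XC] [cite: Hartshorne1977, III Prop. 8.1] -/
theorem quasiIso_pushforward_map_of_injective_of_isAffineLocalizing [IsAffineHom g] {E I : CochainComplex X.Modules ℤ}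
    (ι : E ⟶ I) [QuasiIso ι] (a : ℤ) [E.IsStrictlyGE a] [I.IsStrictlyGE a]
    (hE : ∀ n, IsAffineLocalizing (E.X n)) [hI : ∀ n, Injective (I.X n)] :
    QuasiIso (((Scheme.Modules.pushforward g).mapHomologicalComplex (ComplexShape.up ℤ)).map ι) :=
  quasiIso_pushforward_map_of_isPushforwardAcyclic g ι a
    (fun n => IsPushforwardAcyclic.of_isAffineLocalizing g (hE n))
    (fun n => IsPushforwardAcyclic.of_injective g (I.X n))

/-- **Injective resolutions along an affine morphism**: every bounded-below complex `E•` of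
affine-localizing `𝒪_X`-modules admits a quasi-isomorphism `ι : E• → I•` into a bounded-below complex of
injective `𝒪_X`-modules (enough injectives in `Mod(𝒪_X)`, Grothendieck–Hartshorne III.2.2; Mathlib's
factorisation `CochainComplex.Plus.modelCategoryQuillen.exists_quasiIso_injective`) SUCH THAT `g_* ι` is
again a quasi-isomorphism. [cite: StacksProject, Tag 01XC] [cite: Hartshorne1977, III.2.2 and III Prop. 8.1] -/
theorem exists_injectiveResolution_pushforward_quasiIso [IsAffineHom g] (E : CochainComplex X.Modules ℤ)
    (a : ℤ) [E.IsStrictlyGE a] (hE : ∀ n, IsAffineLocalizing (E.X n)) :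
    ∃ (I : CochainComplex X.Modules ℤ) (ι : E ⟶ I) (_ : QuasiIso ι) (_ : ∀ n, Injective (I.X n))
      (_ : I.IsStrictlyGE a),
      QuasiIso (((Scheme.Modules.pushforward g).mapHomologicalComplex (ComplexShape.up ℤ)).map ι) := by
  obtain ⟨I, ι, hι, hI, hIa⟩ := CochainComplex.Plus.modelCategoryQuillen.exists_quasiIso_injective E a
  haveI := hι
  haveI := hI
  haveI := hIa
  exact ⟨I, ι, hι, hI, hIa, quasiIso_pushforward_map_of_injective_of_isAffineLocalizing g ι a hE⟩

end Leray

end Literature.AlgebraicGeometry.Modules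

end
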